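import Literature.Analysis.FluidPDE.Tao2016AveragedNS.ReachCertificateSharp
import HarnessLib

/-!
# The scaling symmetry of Tao's gate in the reach interface: CONE certificates

HONEST FRAMING: low prior, high value-of-information experiment on Tao's machine paradigm; NOT a
claim that NS blows up.

Every member `delayCircuitWith K M ε` of Tao's delay-circuit family [Tao2016AveragedNS, §5.5 (5.5)]
is a HOMOGENEOUS QUADRATIC vector field: `F(c • X) = c² • F(X)` (`delayCircuitWith_smul`). Hence
the one-parameter SCALING GROUP `X(t) ↦ c • X(ct)` maps exact trajectories to exact trajectories
and `δ`-pseudo-orbits on `[0,T]` to `c²δ`-pseudo-orbits on `[0, T/c]` (`IsPseudoOrbit.rescaleWith`;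
compare `IsPseudoOrbit.rescale`, CircuitShadowing.lean, for the level-`n` copies of Tao's member):
a datum with MORE energy than (5.6) — `c • delayInit`, `c > 1` — runs through the same delayed
abrupt transition, only FASTER (fired at time `2/c`), and tolerates a LARGER forcing (`c²`-fold).
This is the mechanism by which one generation of Tao's cascade hands its (slightly uncertain)
energy to the next [Tao2016AveragedNS, §5.5–§6]: the ODE analysis is scale-free.

The reach certificates of `ReachCertificateSharp.lean` (`taoReachSharp`) and `DefectWeight.lean`
(`taoReachW`) have ISOTROPIC input sets `closedBall delayInit ρ` with `ρ < 1.2535·ε²e^{-M}/√M` —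
necessarily so in the trigger direction (`isEmpty_taoReach_of_ge`: a dud pre-load of that size
defeats the gate), but NOT in the radial direction, where the gate tolerates any factor `c ≥ c₀`.
Since the fired state of generation `n` pins the transferred energy only to relative accuracy
`12/K²⁰ ≫ ε²e^{-M}/√M` (Theorem 5.3), an isotropic input ball cannot receive the previous
generation's output under ANY fixed renormalisation (`not_handOff_image_firedSet_subset`,
`not_handOff_of_lt_dudLevel`): the
isotropic certificates are not composable along the cascade as typed. This file supplies the
composable form.

* §1 HOMOGENEITY: `delayCircuitWith_smul`, `energy_smul'`.
* §2 PSEUDO-ORBITS UNDER SCALING: `IsPseudoOrbit.restrict`, `IsPseudoOrbit.of_le`,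
  `IsPseudoOrbit.rescaleWith`.
* §3 CONFINEMENT WITHOUT AN AMBIENT BOUND: `isPseudoOrbit_of_energy` — a continuous curve with
  right derivative `δ`-close to a member, issued with energy `≤ E₀`, `E₀ + 20δT < 4`, IS a
  pseudo-orbit in the sup-ball of radius `2` with energy `≤ E₀ + 20δt` (first-exit argument on the
  almost-conserved energy; no working region needed).
* §4 CONES: `coneFrom c₀ A = {c • q | c ≥ c₀, q ∈ A}`; the input cone is thick around every
  scaled datum (`ball_smul_delayInit_subset_coneFrom`, cf. the cell's `core_thick`).
* §5 THE CONE CERTIFICATE `reachCertificateCone` (core: `coneCertificate_core`): if every `(εd/c₀²)`-pseudo-orbit from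
  `closedBall delayInit ρ` is in `A` at time `2`, then for the SAME defect level `εd`, working region
  `U = univ`, cycle time `2/c₀`, input set `coneFrom c₀ (closedBall delayInit ρ)` and output set
  `coneFrom c₀ A` the reach interface of the cell (`FluidComputer/ReachCertificate.lean`) is
  inhabited (`c₀ > 0`, size condition `7ρ + 40εd/c₀² ≤ 5/4`); tube from `p`: the closed
  sup-ball of radius `(3/2)‖p‖/(1 - ρ)`.
* §6 TAO'S GATE, SCALE-COVARIANTLY: `taoReachCone` — under the standing hypotheses, for all
  `c₀ > 0`, `ρ, εd ≥ 0` with `ρ + 2εd/c₀² < 1.2532·ε²e^{-M}/√M`, a certificate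
  `ReachCertificate (delayCircuitWith K M ε) univ εd (2/c₀) (coneFrom c₀ (closedBall delayInit ρ))
  (coneFrom c₀ (firedSet K 6 4))`; `taoReachCone_one` (`c₀ = 1`: cycle time `2`, every input
  `c • q`, `c ≥ 1`).
* §8 BANDS: `bandFrom c₀ c₁ A = {c • q | c₀ ≤ c ≤ c₁, q ∈ A}`; the gate PRESERVES the level
  exactly (`coneCertificate_core`, `reachCertificateBand`, `taoReachBand`: certificates from
  `bandFrom c₀ c₁ (closedBall delayInit ρ)` into `bandFrom c₀ c₁ (firedSet K 6 4)`), while the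
  design hand-off at unit `r` drifts it upward by at most the factor `(1 + e/K²⁰)/r` per generation
  (`handOff_image_bandFrom_firedSet_subset`) — so a cascade spec's per-generation energies can only
  be floors (DIVERGENCE D37 (d)).
* §7 COMPOSABILITY (the dictionary entry "generation hand-off ↔ `ReachCircuit.handoff`"): the
  DESIGN hand-off `handOff r z = (z 4 / r) • delayInit` (the output mode becomes the next carrier,
  fresh modes empty, amplitudes re-read in units of the transferred-energy FLOOR `r = 1 - e/K²⁰`)
  maps `coneFrom c₀ (firedSet K e m)` INTO `coneFrom c₀ (closedBall delayInit ρ)` — the cone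
  certificate composes with itself with the same `c₀` (`handOff_image_coneFrom_firedSet_subset`,
  `handOff_taoReachCone_chains`); whereas NO renormalisation `r` maps `firedSet K 6 4` into
  `closedBall delayInit ρ` once `ρ < 6/K²⁰` (`not_handOff_image_firedSet_subset`) — in particular
  never for the radii `ρ < 1.2535·ε²e^{-M}/√M` beyond which no isotropic certificate exists
  (`dudLevel_lt_handOff_spread`, `not_handOff_of_lt_dudLevel`).

What is NOT claimed: tolerance in the four transverse directions beyond `ρ` (the trigger direction
is genuinely fragile at `1.2535·ε²e^{-M}/√M`; the clock / conduit / output directions are not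
analysed separately); anything fluid-side (junk in the fresh modes is the consumer's `handoff`
obligation); anything about Navier–Stokes.
-/

noncomputable section

open Real Set MeasureTheory Metric
open scoped NNReal
open Literature.Analysis.FluidPDE.FluidComputer (ReachCertificate)

namespace Literature.Analysis.FluidPDE.Tao2016AveragedNS

/-! ## §1. Homogeneity -/

/-- **Every member is a homogeneous quadratic field**: `F(c • X) = c² • F(X)`.
[cite: Tao2016AveragedNS, §5.5 (5.5)] -/
theorem delayCircuitWith_smul (K M ε c : ℝ) (X : Fin 5 → ℝ) :
    delayCircuitWith K M ε (c • X) = c ^ 2 • delayCircuitWith K M ε X := by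
  funext i
  fin_cases i <;> simp [delayCircuitWith, smul_eq_mul] <;> ring

/-- Energy is quadratic: `energy (c • X) = c² · energy X`. [folklore] -/
theorem energy_smul' (c : ℝ) (X : Fin 5 → ℝ) : energy (c • X) = c ^ 2 * energy X := by
  simp only [energy, Pi.smul_apply, smul_eq_mul, mul_pow, Finset.mul_sum]

/-- The norm of `delayInit` is `1`. [cite: Tao2016AveragedNS, §5.5 (5.6)] -/
theorem norm_delayInit : ‖delayInit‖ = 1 := by
  refine le_antisymm ?_ ?_
  · refine (pi_norm_le_iff_of_nonneg zero_le_one).2 fun i => ?_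
    fin_cases i <;> simp [delayInit]
  · have h := norm_le_pi_norm delayInit 0
    simpa [delayInit] using h

/-! ## §2. Pseudo-orbits under restriction, weakening and scaling -/

section PseudoOrbit

variable {K M ε : ℝ}

/-- Restriction of a pseudo-orbit to a shorter window. [folklore] -/
theorem IsPseudoOrbit.restrict {F : (Fin 5 → ℝ) → (Fin 5 → ℝ)} {δ T T' : ℝ} {R : ℝ≥0}
    {Y : ℝ → Fin 5 → ℝ} (h : IsPseudoOrbit F δ R T Y) (hT : T' ≤ T) : IsPseudoOrbit F δ R T' Y where
  continuousOn := h.continuousOn.mono (Icc_subset_Icc_right hT)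
  defect := fun t ht => h.defect t ⟨ht.1, lt_of_lt_of_le ht.2 hT⟩
  norm_le := fun t ht => h.norm_le t ⟨ht.1, lt_of_lt_of_le ht.2 hT⟩

/-- A pseudo-orbit with defect `δ` is one with any larger defect. [folklore] -/
theorem IsPseudoOrbit.of_le {F : (Fin 5 → ℝ) → (Fin 5 → ℝ)} {δ δ' T : ℝ} {R : ℝ≥0}
    {Y : ℝ → Fin 5 → ℝ} (h : IsPseudoOrbit F δ R T Y) (hδ : δ ≤ δ') : IsPseudoOrbit F δ' R T Y where
  continuousOn := h.continuousOn
  defect := fun t ht => by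
    obtain ⟨V, hV, hVd⟩ := h.defect t ht
    exact ⟨V, hV, hVd.trans hδ⟩
  norm_le := h.norm_le

/-- Right derivative of a time-dilated curve: if `y` has right derivative `W` at `a·t` then
`t ↦ y (a t)` has right derivative `a • W` at `t` (`a > 0`). [folklore] -/
theorem hasDerivWithinAt_comp_mul {y : ℝ → Fin 5 → ℝ} {W : Fin 5 → ℝ} {a t : ℝ} (ha : 0 < a)
    (hy : HasDerivWithinAt y W (Ici (a * t)) (a * t)) :
    HasDerivWithinAt (fun s => y (a * s)) (a • W) (Ici t) t := by
  have hm : HasDerivWithinAt (fun s : ℝ => a * s) a (Ici t) t := by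
    simpa using (hasDerivWithinAt_id t (Ici t)).const_mul a
  have hmaps : MapsTo (fun s : ℝ => a * s) (Ici t) (Ici (a * t)) := fun s hs =>
    mul_le_mul_of_nonneg_left hs ha.le
  exact hy.scomp t hm hmaps

/-- **Scaling covariance of pseudo-orbits.** If `Y` is a `δ`-pseudo-orbit of a member in the
sup-ball of radius `R` over `[0,T]`, then `t ↦ c • Y (c t)` (`c > 0`) is a `δ'`-pseudo-orbit in
the sup-ball of radius `R'` over `[0, T/c]` for any `δ' ≥ c²δ`, `R' ≥ cR` (homogeneity, §1).
[cite: Tao2016AveragedNS, §5.5 (5.5)] -/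
theorem IsPseudoOrbit.rescaleWith {δ δ' T c : ℝ} {R R' : ℝ≥0} {Y : ℝ → Fin 5 → ℝ}
    (h : IsPseudoOrbit (delayCircuitWith K M ε) δ R T Y) (hc : 0 < c) (hR : c * (R : ℝ) ≤ R')
    (hδ : c ^ 2 * δ ≤ δ') :
    IsPseudoOrbit (delayCircuitWith K M ε) δ' R' (T / c) (fun t => c • Y (c * t)) where
  continuousOn := by
    have hmaps : MapsTo (fun t : ℝ => c * t) (Icc 0 (T / c)) (Icc 0 T) := by
      intro t ht
      refine ⟨mul_nonneg hc.le ht.1, ?_⟩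
      have := mul_le_mul_of_nonneg_left ht.2 hc.le
      rwa [mul_div_cancel₀ _ hc.ne'] at this
    exact ((h.continuousOn.comp (continuous_const_mul c).continuousOn hmaps)).const_smul c
  defect := by
    intro t ht
    have hct : c * t ∈ Ico 0 T := by
      refine ⟨mul_nonneg hc.le ht.1, ?_⟩
      have := mul_lt_mul_of_pos_left ht.2 hc
      rwa [mul_div_cancel₀ _ hc.ne'] at this
    obtain ⟨V, hV, hVd⟩ := h.defect (c * t) hct
    refine ⟨c • (c • V), (hasDerivWithinAt_comp_mul hc hV).const_smul c, ?_⟩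
    rw [delayCircuitWith_smul, smul_smul, ← pow_two, ← smul_sub, norm_smul, Real.norm_eq_abs,
      abs_of_nonneg (sq_nonneg c)]
    exact (mul_le_mul_of_nonneg_left hVd (sq_nonneg c)).trans hδ
  norm_le := by
    intro t ht
    have hct : c * t ∈ Ico 0 T := by
      refine ⟨mul_nonneg hc.le ht.1, ?_⟩
      have := mul_lt_mul_of_pos_left ht.2 hc
      rwa [mul_div_cancel₀ _ hc.ne'] at this
    rw [norm_smul, Real.norm_eq_abs, abs_of_pos hc]
    exact (mul_le_mul_of_nonneg_left (h.norm_le _ hct) hc.le).trans hR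

end PseudoOrbit

/-! ## §3. Confinement without an ambient bound -/

/-- **A curve with small defect from a member is a pseudo-orbit in the sup-ball of radius `2`,
with almost-conserved energy** — no working region assumed: if `x` is continuous on `[0,T]` with
right derivative `δ`-close to `delayCircuitWith K M ε` on `[0,T)`, `energy (x 0) ≤ E₀` and
`E₀ + 20δT < 4`, then `‖x t‖ ≤ 2`-confinement never fails (at the first time `‖x‖ = 2` the energy
would be `< 4`), so `x` is a `δ`-pseudo-orbit in the sup-ball of radius `2` and
`energy (x t) ≤ E₀ + 20δt` on `[0,T]`. [cite: Tao2016AveragedNS, §5 (g-cancel)] -/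
theorem isPseudoOrbit_of_energy {K M ε δ T E₀ : ℝ} {x : ℝ → Fin 5 → ℝ}
    (hcont : ContinuousOn x (Icc 0 T))
    (hdef : ∀ t ∈ Ico 0 T, ∃ V : Fin 5 → ℝ,
      HasDerivWithinAt x V (Ici t) t ∧ ‖V - delayCircuitWith K M ε (x t)‖ ≤ δ)
    (hδ : 0 ≤ δ) (hE0 : energy (x 0) ≤ E₀) (hE : E₀ + 20 * δ * T < 4) :
    IsPseudoOrbit (delayCircuitWith K M ε) δ 2 T x ∧
      ∀ t ∈ Icc 0 T, energy (x t) ≤ E₀ + 20 * δ * t := by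
  -- Step 1: the sup norm stays below 2 on [0,T].
  have hlt : ∀ t ∈ Icc 0 T, ‖x t‖ < 2 := by
    by_contra hcon
    simp only [not_forall, not_lt, exists_prop] at hcon
    set S : Set ℝ := {t | t ∈ Icc 0 T ∧ 2 ≤ ‖x t‖} with hS
    have hSne : S.Nonempty := by
      obtain ⟨t, ht, h2⟩ := hcon
      exact ⟨t, ht, h2⟩
    have hSbdd : BddBelow S := ⟨0, fun t ht => ht.1.1⟩
    have hSclosed : IsClosed S := by
      have hc : ContinuousOn (fun t => ‖x t‖) (Icc 0 T) := hcont.norm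
      have := hc.preimage_isClosed_of_isClosed isClosed_Icc (isClosed_Ici (a := (2 : ℝ)))
      have hS' : S = Icc 0 T ∩ (fun t => ‖x t‖) ⁻¹' Ici 2 := by
        ext t; simp [hS, mem_Ici]
      rw [hS']
      exact this
    set t₀ := sInf S with ht₀
    have ht₀S : t₀ ∈ S := hSclosed.csInf_mem hSne hSbdd
    have ht₀T : t₀ ∈ Icc 0 T := ht₀S.1
    have hbefore : ∀ s ∈ Ico 0 t₀, ‖x s‖ ≤ 2 := by
      intro s hs
      by_contra h2
      rw [not_le] at h2
      have hsS : s ∈ S := ⟨⟨hs.1, (hs.2.le.trans ht₀T.2)⟩, h2.le⟩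
      exact absurd (csInf_le hSbdd hsS) (not_le.2 hs.2)
    have hpo : IsPseudoOrbit (delayCircuitWith K M ε) δ 2 t₀ x :=
      { continuousOn := hcont.mono (Icc_subset_Icc_right ht₀T.2)
        defect := fun s hs => hdef s ⟨hs.1, lt_of_lt_of_le hs.2 ht₀T.2⟩
        norm_le := fun s hs => by simpa using hbefore s hs }
    have hdrift := hpo.abs_energy_sub_le (t := t₀) ⟨ht₀T.1, le_rfl⟩
    have hEt : energy (x t₀) < 4 := by
      have h1 := (abs_le.1 hdrift).2
      have h2 : 20 * δ * t₀ ≤ 20 * δ * T := by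
        have := ht₀T.2
        nlinarith
      linarith
    have hn : ‖x t₀‖ < 2 := by
      refine lt_of_le_of_lt (norm_le_sqrt_energy (x t₀)) ?_
      rw [show (2 : ℝ) = Real.sqrt 4 by
        rw [show (4 : ℝ) = 2 ^ 2 by norm_num, Real.sqrt_sq (by norm_num)]]
      exact Real.sqrt_lt_sqrt (by unfold energy; positivity) hEt
    exact absurd ht₀S.2 (not_le.2 hn)
  have hpo : IsPseudoOrbit (delayCircuitWith K M ε) δ 2 T x :=
    { continuousOn := hcont
      defect := hdef
      norm_le := fun s hs => by simpa using (hlt s ⟨hs.1, hs.2.le⟩).le }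
  refine ⟨hpo, fun t ht => ?_⟩
  have h1 := (abs_le.1 (hpo.abs_energy_sub_le ht)).2
  linarith

/-! ## §4. Cones -/

/-- **The cone over a set from level `c₀`**: all `c • q` with `c ≥ c₀`, `q ∈ A` — the input /
output sets of the scale-covariant certificates. [cite: Tao2016AveragedNS, Remark 6.1] -/
def coneFrom (c₀ : ℝ) (A : Set (Fin 5 → ℝ)) : Set (Fin 5 → ℝ) :=
  {p | ∃ c : ℝ, c₀ ≤ c ∧ ∃ q ∈ A, p = c • q}

/-- Scaled members of `A` lie in the cone. [folklore] -/
theorem smul_mem_coneFrom {c₀ c : ℝ} {A : Set (Fin 5 → ℝ)} {q : Fin 5 → ℝ} (hc : c₀ ≤ c)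
    (hq : q ∈ A) : c • q ∈ coneFrom c₀ A :=
  ⟨c, hc, q, hq, rfl⟩

/-- For `c₀ ≤ 1` the cone contains the set. [folklore] -/
theorem subset_coneFrom {c₀ : ℝ} (hc : c₀ ≤ 1) (A : Set (Fin 5 → ℝ)) : A ⊆ coneFrom c₀ A :=
  fun q hq => ⟨1, hc, q, hq, (one_smul ℝ q).symm⟩

/-- Cones are monotone in the set. [folklore] -/
theorem coneFrom_mono {c₀ : ℝ} {A B : Set (Fin 5 → ℝ)} (h : A ⊆ B) : coneFrom c₀ A ⊆ coneFrom c₀ B := by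
  rintro p ⟨c, hc, q, hq, rfl⟩
  exact ⟨c, hc, q, h hq, rfl⟩

/-- Cones from a nonnegative level are closed under scaling up. [folklore] -/
theorem smul_mem_coneFrom_of_mem {c₀ d : ℝ} {A : Set (Fin 5 → ℝ)} {p : Fin 5 → ℝ} (hc₀ : 0 ≤ c₀)
    (hd : 1 ≤ d) (hp : p ∈ coneFrom c₀ A) : d • p ∈ coneFrom c₀ A := by
  obtain ⟨c, hc, q, hq, rfl⟩ := hp
  refine ⟨d * c, ?_, q, hq, by rw [smul_smul]⟩
  nlinarith

/-- **The input cone is thick around every scaled datum**: the open sup-ball of radius `cρ` around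
`c • delayInit` (`c ≥ c₀`, `c > 0`) lies in `coneFrom c₀ (closedBall delayInit ρ)` — what the
cell's `core_thick` field asks of an input region. [folklore] -/
theorem ball_smul_delayInit_subset_coneFrom {c₀ c ρ : ℝ} (hc : c₀ ≤ c) (hc0 : 0 < c) :
    ball (c • delayInit) (c * ρ) ⊆ coneFrom c₀ (closedBall delayInit ρ) := by
  intro p hp
  refine ⟨c, hc, c⁻¹ • p, ?_, by rw [smul_smul, mul_inv_cancel₀ hc0.ne', one_smul]⟩
  rw [mem_closedBall, dist_eq_norm]
  rw [mem_ball, dist_eq_norm] at hp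
  have h : c⁻¹ • p - delayInit = c⁻¹ • (p - c • delayInit) := by
    rw [smul_sub, smul_smul, inv_mul_cancel₀ hc0.ne', one_smul]
  rw [h, norm_smul, Real.norm_eq_abs, abs_of_pos (inv_pos.2 hc0)]
  rw [inv_mul_le_iff₀ hc0]
  exact hp.le

/-! ## §5. The cone certificate -/

/-- **The core of the cone certificates.** Under the hypotheses of `reachCertificateCone`, an
admissible curve `y` (continuous on `[0, σT]`, right derivative `εd`-close to the member,
`σT ≤ 2/c₀`) issued from `c • q` with `c ≥ c₀`, `‖q - delayInit‖ ≤ ρ` stays in the sup-ball of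
radius `(3/2)‖c • q‖/(1 - ρ)`, and over the full cycle `σT = 2/c₀` it sits at time `2/c ≤ 2/c₀` at
`c • w` for some `w ∈ A` — THE LEVEL `c` IS PRESERVED EXACTLY. (Rescale to `x(t) = c⁻¹ • y(t/c)`,
a curve from `q` with defect `εd/c² ≤ εd/c₀²`, confine it by energy (§3), read `A` at time `2`.)
[cite: Tao2016AveragedNS, §5.5 Theorem 5.3, Remark 6.1] -/
theorem coneCertificate_core {K M ε c₀ ρ εd : ℝ} {A : Set (Fin 5 → ℝ)}
    (hF : ∀ x : ℝ → Fin 5 → ℝ, IsPseudoOrbit (delayCircuitWith K M ε) (εd / c₀ ^ 2) 2 2 x →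
      ‖x 0 - delayInit‖ ≤ ρ → x 2 ∈ A)
    (hc₀ : 0 < c₀) (hεd : 0 ≤ εd) (hsm : 7 * ρ + 40 * (εd / c₀ ^ 2) ≤ 5 / 4)
    {c : ℝ} (hc : c₀ ≤ c) {q : Fin 5 → ℝ} (hq : q ∈ closedBall delayInit ρ)
    {σT : ℝ} {y : ℝ → Fin 5 → ℝ} (h0 : 0 ≤ σT) (hσT : σT ≤ 2 / c₀) (hy0 : y 0 = c • q)
    (hcont : ContinuousOn y (Icc 0 σT))
    (hW : ∀ σ ∈ Ico 0 σT, ∃ W : Fin 5 → ℝ, HasDerivWithinAt y W (Ici σ) σ ∧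
      ‖W - delayCircuitWith K M ε (y σ)‖ ≤ εd) :
    y σT ∈ closedBall (0 : Fin 5 → ℝ) (3 / 2 * ‖c • q‖ / (1 - ρ)) ∧
      (σT = 2 / c₀ → 2 / c ∈ Icc 0 (2 / c₀) ∧ ∃ w ∈ A, y (2 / c) = c • w) := by
  have hc0 : 0 < c := lt_of_lt_of_le hc₀ hc
  have hρ1 : ρ ≤ 5 / 28 := by
    have : (0 : ℝ) ≤ 40 * (εd / c₀ ^ 2) := by positivity
    linarith
  rw [mem_closedBall, dist_eq_norm] at hq
  have hq1 : 1 - ρ ≤ ‖q‖ := by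
    have h1 := norm_sub_norm_le delayInit q
    rw [norm_delayInit, norm_sub_rev] at h1
    linarith
  -- the rescaled curve `x t = c⁻¹ • y (c⁻¹ t)` on `[0, c σT]`
  set x : ℝ → Fin 5 → ℝ := fun t => c⁻¹ • y (c⁻¹ * t) with hx
  have hmapsIcc : MapsTo (fun t : ℝ => c⁻¹ * t) (Icc 0 (c * σT)) (Icc 0 σT) := by
    intro t ht
    refine ⟨mul_nonneg (inv_pos.2 hc0).le ht.1, ?_⟩
    have := mul_le_mul_of_nonneg_left ht.2 (inv_pos.2 hc0).le
    rwa [← mul_assoc, inv_mul_cancel₀ hc0.ne', one_mul] at this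
  have hxcont : ContinuousOn x (Icc 0 (c * σT)) :=
    (hcont.comp (continuous_const_mul c⁻¹).continuousOn hmapsIcc).const_smul c⁻¹
  have hxdef : ∀ t ∈ Ico 0 (c * σT), ∃ V : Fin 5 → ℝ, HasDerivWithinAt x V (Ici t) t ∧
      ‖V - delayCircuitWith K M ε (x t)‖ ≤ εd / c ^ 2 := by
    intro t ht
    have hs : c⁻¹ * t ∈ Ico 0 σT := by
      refine ⟨mul_nonneg (inv_pos.2 hc0).le ht.1, ?_⟩
      have := mul_lt_mul_of_pos_left ht.2 (inv_pos.2 hc0)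
      rwa [← mul_assoc, inv_mul_cancel₀ hc0.ne', one_mul] at this
    obtain ⟨W, hW1, hW2⟩ := hW (c⁻¹ * t) hs
    refine ⟨c⁻¹ • (c⁻¹ • W), (hasDerivWithinAt_comp_mul (inv_pos.2 hc0) hW1).const_smul c⁻¹, ?_⟩
    show ‖c⁻¹ • (c⁻¹ • W) - delayCircuitWith K M ε (c⁻¹ • y (c⁻¹ * t))‖ ≤ εd / c ^ 2
    rw [delayCircuitWith_smul, smul_smul, ← pow_two, ← smul_sub, norm_smul, Real.norm_eq_abs,
      abs_of_nonneg (sq_nonneg _), inv_pow]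
    calc (c ^ 2)⁻¹ * ‖W - delayCircuitWith K M ε (y (c⁻¹ * t))‖ ≤ (c ^ 2)⁻¹ * εd :=
          mul_le_mul_of_nonneg_left hW2 (inv_nonneg.2 (sq_nonneg c))
      _ = εd / c ^ 2 := by rw [div_eq_mul_inv, mul_comm]
  have hx0 : x 0 = q := by
    simp only [hx, mul_zero, hy0, smul_smul, inv_mul_cancel₀ hc0.ne', one_smul]
  have hE0 : energy (x 0) ≤ 1 + 7 * ρ := by
    rw [hx0]
    have := (abs_le.1 (Ignition.abs_energy_init_le hq (by linarith))).2
    linarith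
  -- the energy drift over the rescaled horizon `c σT ≤ 2c/c₀` is at most `40 εd/c₀²`
  have hdrift : 20 * (εd / c ^ 2) * (c * σT) ≤ 40 * (εd / c₀ ^ 2) := by
    have e1 : 20 * (εd / c ^ 2) * (c * σT) = 20 * εd * σT / c := by
      field_simp
    rw [e1, div_le_iff₀ hc0]
    have h1 : 20 * εd * σT ≤ 40 * εd / c₀ := by
      calc 20 * εd * σT ≤ 20 * εd * (2 / c₀) :=
            mul_le_mul_of_nonneg_left hσT (by positivity)
        _ = 40 * εd / c₀ := by ring
    have h2 : 40 * εd / c₀ ≤ 40 * (εd / c₀ ^ 2) * c := by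
      rw [div_le_iff₀ hc₀]
      have h3 : εd ≤ εd / c₀ ^ 2 * c * c₀ := by
        calc εd = εd / c₀ ^ 2 * c₀ * c₀ := by field_simp
          _ ≤ εd / c₀ ^ 2 * c * c₀ := by gcongr
      linarith
    linarith
  have hbudget : 1 + 7 * ρ + 20 * (εd / c ^ 2) * (c * σT) < 4 := by linarith
  obtain ⟨hxpo, hxE⟩ := isPseudoOrbit_of_energy hxcont hxdef (by positivity) hE0 hbudget
  have hyx : ∀ σ, y σ = c • x (c * σ) := fun σ => by
    simp only [hx, smul_smul, mul_inv_cancel₀ hc0.ne', one_smul, ← mul_assoc,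
      inv_mul_cancel₀ hc0.ne', one_mul]
  refine ⟨?_, fun hτ => ?_⟩
  · -- tube: energy confinement of `x` at time `c σT`, scaled back
    have hEx := hxE (c * σT) ⟨by positivity, le_rfl⟩
    have hn : ‖x (c * σT)‖ ≤ 3 / 2 := norm_le_three_halves_of_energy_le (by linarith)
    have hcq : ‖c • q‖ = c * ‖q‖ := by
      rw [norm_smul, Real.norm_eq_abs, abs_of_pos hc0]
    have hcx : ‖c • x (c * σT)‖ = c * ‖x (c * σT)‖ := by
      rw [norm_smul, Real.norm_eq_abs, abs_of_pos hc0]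
    have h1ρ : 0 < 1 - ρ := by linarith
    rw [mem_closedBall_zero_iff, hyx σT, hcx, hcq, le_div_iff₀ h1ρ]
    have h1 : c * ‖x (c * σT)‖ ≤ c * (3 / 2) := mul_le_mul_of_nonneg_left hn hc0.le
    nlinarith [mul_le_mul h1 hq1 h1ρ.le (by positivity)]
  · -- reach: `x` restricted to `[0,2]` is a pseudo-orbit from `q` with defect `≤ εd/c₀²`
    subst hτ
    have h2 : (2 : ℝ) ≤ c * (2 / c₀) := by
      rw [mul_div_assoc', le_div_iff₀ hc₀]
      linarith [mul_le_mul_of_nonneg_left hc (by norm_num : (0 : ℝ) ≤ 2)]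
    have hx2 : IsPseudoOrbit (delayCircuitWith K M ε) (εd / c₀ ^ 2) 2 2 x :=
      (hxpo.restrict h2).of_le
        (div_le_div_of_nonneg_left hεd (by positivity) (pow_le_pow_left₀ hc₀.le hc 2))
    have hxq : ‖x 0 - delayInit‖ ≤ ρ := by
      rw [hx0]
      exact hq
    have hA := hF x hx2 hxq
    refine ⟨⟨by positivity, div_le_div_of_nonneg_left (by norm_num) hc₀ hc⟩, x 2, hA, ?_⟩
    rw [hyx (2 / c), show c * (2 / c) = 2 by field_simp]

/-- **THE CONE CERTIFICATE.** Suppose every `(εd/c₀²)`-pseudo-orbit of the member in the sup-ball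
of radius `2` over `[0,2]` issued `ρ`-close to (5.6) is in `A` at time `2` (`c₀ > 0`,
`ρ, εd ≥ 0`, size condition `7ρ + 40εd/c₀² ≤ 5/4`). Then the cell's reach interface is inhabited
with: `F = delayCircuitWith K M ε`, working region `U = univ` (no ambient bound is needed, §3),
defect `εd`, cycle time `2/c₀`, INPUT CONE `coneFrom c₀ (closedBall delayInit ρ)`, OUTPUT CONE
`coneFrom c₀ A`; tube from `p`: the closed sup-ball of radius `(3/2)‖p‖/(1 - ρ)`. Proof: an
admissible curve `y` from `p = c • q` is rescaled to `x(t) = c⁻¹ • y(t/c)` — a curve from `q` with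
defect `εd/c² ≤ εd/c₀²` (homogeneity), confined by energy (§3); it is in `A` at time `2`, so `y` is
in `c • A ⊆ coneFrom c₀ A` at time `2/c ≤ 2/c₀`. [cite: Tao2016AveragedNS, §5.5 Theorem 5.3, Remark 6.1] -/
def reachCertificateCone {K M ε c₀ ρ εd : ℝ} {A : Set (Fin 5 → ℝ)}
    (hF : ∀ x : ℝ → Fin 5 → ℝ, IsPseudoOrbit (delayCircuitWith K M ε) (εd / c₀ ^ 2) 2 2 x →
      ‖x 0 - delayInit‖ ≤ ρ → x 2 ∈ A)
    (hc₀ : 0 < c₀) (hρ : 0 ≤ ρ) (hεd : 0 ≤ εd)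
    (hsm : 7 * ρ + 40 * (εd / c₀ ^ 2) ≤ 5 / 4) :
    ReachCertificate (delayCircuitWith K M ε) (univ : Set (Fin 5 → ℝ)) εd (2 / c₀)
      (coneFrom c₀ (closedBall delayInit ρ)) (coneFrom c₀ A) where
  Tube p _ := closedBall (0 : Fin 5 → ℝ) (3 / 2 * ‖p‖ / (1 - ρ))
  Tube_closed p _ := by
    have h : {z : ℝ × (Fin 5 → ℝ) | z.1 ∈ Icc (0 : ℝ) (2 / c₀) ∧
        z.2 ∈ closedBall (0 : Fin 5 → ℝ) (3 / 2 * ‖p‖ / (1 - ρ))}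
        = Icc (0 : ℝ) (2 / c₀) ×ˢ closedBall (0 : Fin 5 → ℝ) (3 / 2 * ‖p‖ / (1 - ρ)) := by
      ext z
      simp
    rw [h]
    exact isClosed_Icc.prod isClosed_closedBall
  Tube_zero p _ := by
    have hρ1 : ρ ≤ 5 / 28 := by
      have : (0 : ℝ) ≤ 40 * (εd / c₀ ^ 2) := by positivity
      linarith
    rw [mem_closedBall_zero_iff, le_div_iff₀ (by linarith)]
    nlinarith [norm_nonneg p]
  Tube_sub _ _ _ _ := subset_univ _
  cert p hp σT y h0 hσT hy0 hcont _ hW := by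
    obtain ⟨c, hc, q, hq, rfl⟩ := hp
    obtain ⟨h1, h2⟩ := coneCertificate_core hF hc₀ hεd hsm hc hq h0 hσT hy0 hcont hW
    refine ⟨h1, fun hτ => ?_⟩
    obtain ⟨hI, w, hw, hyw⟩ := h2 hτ
    exact ⟨2 / c, hI, by rw [hyw]; exact ⟨c, hc, w, hw, rfl⟩⟩

/-- The tube of the cone certificate from `p` is the closed sup-ball of radius `(3/2)‖p‖/(1 - ρ)`.
[folklore] -/
theorem reachCertificateCone_tube {K M ε c₀ ρ εd : ℝ} {A : Set (Fin 5 → ℝ)}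
    (hF : ∀ x : ℝ → Fin 5 → ℝ, IsPseudoOrbit (delayCircuitWith K M ε) (εd / c₀ ^ 2) 2 2 x →
      ‖x 0 - delayInit‖ ≤ ρ → x 2 ∈ A)
    (hc₀ : 0 < c₀) (hρ : 0 ≤ ρ) (hεd : 0 ≤ εd)
    (hsm : 7 * ρ + 40 * (εd / c₀ ^ 2) ≤ 5 / 4) (p : Fin 5 → ℝ) (σ : ℝ) :
    (reachCertificateCone hF hc₀ hρ hεd hsm).Tube p σ =
      closedBall (0 : Fin 5 → ℝ) (3 / 2 * ‖p‖ / (1 - ρ)) :=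
  rfl

/-! ## §6. Tao's gate, scale-covariantly -/

section Standing

variable {K M ε : ℝ} (hK : 2 * 20 ^ 42 * (Nat.factorial 42 : ℝ) + 16 ≤ K)
  (hML : 3000 * Real.log K ≤ M) (hMK : M ≤ K ^ 10) (hε : 0 < ε)
  (hεle : ε ≤ exp (-(10 * M)) / K ^ 100)
include hK hML hMK hε hεle

/-- **Tao's gate inhabits the reach interface on CONES.** For every member under the standing
hypotheses, every level `c₀ > 0` and every `ρ, εd ≥ 0` with `ρ + 2εd/c₀² < 1.2532·ε²e^{-M}/√M`:
a reach certificate with working region `univ`, defect `εd`, cycle time `2/c₀`, from the INPUT CONE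
`{c • q | c ≥ c₀, ‖q - delayInit‖ ≤ ρ}` into the OUTPUT CONE `{c • w | c ≥ c₀, w ∈ firedSet K 6 4}`
(Theorem 5.3's fired state, scaled): every admissible input, however energetic, is delivered FIRED
— at time `2/c`, the faster the more energetic. (The sharp budget of SeedScaleSharpClosure via
`firesUnderBudget_of_lt`; compare `taoReachSharp`: `c₀ = c = 1` only.)
[cite: Tao2016AveragedNS, §5.5 Theorem 5.3, Remark 6.1] -/
def taoReachCone {c₀ ρ εd : ℝ} (hc₀ : 0 < c₀) (hρ : 0 ≤ ρ) (hεd : 0 ≤ εd)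
    (hB : ρ + εd / c₀ ^ 2 * 2 < 3133 / 2500 * (ε ^ 2 * exp (-M)) / Real.sqrt M) :
    ReachCertificate (delayCircuitWith K M ε) (univ : Set (Fin 5 → ℝ)) εd (2 / c₀)
      (coneFrom c₀ (closedBall delayInit ρ)) (coneFrom c₀ (firedSet K 6 4)) :=
  reachCertificateCone
    (fun x hx h0 =>
      (firesUnderBudget_of_lt hK hML hMK hε hεle hB (by norm_num) (by norm_num)) _ _ 2 x le_rfl hx
        h0 le_rfl 2 ⟨le_rfl, le_rfl⟩)
    hc₀ hρ hεd
    (by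
      obtain ⟨h1, h2⟩ := dud_level_le hK hML hMK hε hεle
      have : 0 ≤ εd / c₀ ^ 2 := by positivity
      linarith)

/-- The tube of `taoReachCone` from `p` is the closed sup-ball of radius `(3/2)‖p‖/(1 - ρ)`.
[folklore] -/
theorem taoReachCone_tube {c₀ ρ εd : ℝ} (hc₀ : 0 < c₀) (hρ : 0 ≤ ρ) (hεd : 0 ≤ εd)
    (hB : ρ + εd / c₀ ^ 2 * 2 < 3133 / 2500 * (ε ^ 2 * exp (-M)) / Real.sqrt M)
    (p : Fin 5 → ℝ) (σ : ℝ) :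
    (taoReachCone hK hML hMK hε hεle hc₀ hρ hεd hB).Tube p σ =
      closedBall (0 : Fin 5 → ℝ) (3 / 2 * ‖p‖ / (1 - ρ)) :=
  rfl

/-- **The upward cone** (`c₀ = 1`): cycle time `2`, every input `c • q` with `c ≥ 1`,
`‖q - delayInit‖ ≤ ρ`, under the sharp budget `ρ + 2εd < 1.2532·ε²e^{-M}/√M` — the same numbers as
`taoReachSharp`, with the input ball replaced by the cone above it and `U = univ`.
[cite: Tao2016AveragedNS, §5.5 Theorem 5.3, Remark 6.1] -/
def taoReachCone_one {ρ εd : ℝ} (hρ : 0 ≤ ρ) (hεd : 0 ≤ εd)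
    (hB : ρ + εd * 2 < 3133 / 2500 * (ε ^ 2 * exp (-M)) / Real.sqrt M) :
    ReachCertificate (delayCircuitWith K M ε) (univ : Set (Fin 5 → ℝ)) εd 2
      (coneFrom 1 (closedBall delayInit ρ)) (coneFrom 1 (firedSet K 6 4)) := by
  have h := taoReachCone hK hML hMK hε hεle (c₀ := 1) one_pos hρ hεd
    (by simpa using hB)
  simpa using h

end Standing

/-! ## §7. Composability: the design hand-off between generations -/

/-- **The design hand-off** between generations of Tao's cascade [Tao2016AveragedNS, §5.5–§6]:
the output mode `ã` of generation `n` becomes the carrier `a` of generation `n+1`, the four fresh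
modes of generation `n+1` are empty in the design, and amplitudes are re-read in the next
generation's unit `r` (a multiple of the current one): `handOff r z = (z 4 / r) • delayInit`.
(The readout-level shadow of the cell's `ReachCircuit.handoff` field at zero junk.)
[cite: Tao2016AveragedNS, §6.1 (6.1), (6.4)] -/
def handOff (r : ℝ) (z : Fin 5 → ℝ) : Fin 5 → ℝ := (z 4 / r) • delayInit

/-- The hand-off is homogeneous. [folklore] -/
theorem handOff_smul (r c : ℝ) (z : Fin 5 → ℝ) : handOff r (c • z) = c • handOff r z := by
  simp only [handOff, Pi.smul_apply, smul_eq_mul, smul_smul]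
  congr 1
  ring

/-- Distance of a hand-off from Tao's datum: `‖handOff r z - delayInit‖ = |z 4 / r - 1|`.
[folklore] -/
theorem norm_handOff_sub_delayInit (r : ℝ) (z : Fin 5 → ℝ) :
    ‖handOff r z - delayInit‖ = |z 4 / r - 1| := by
  have h : handOff r z - delayInit = (z 4 / r - 1) • delayInit := by
    rw [handOff, sub_smul, one_smul]
  rw [h, norm_smul, Real.norm_eq_abs, norm_delayInit, mul_one]

/-- **THE CONE CERTIFICATE COMPOSES WITH THE DESIGN HAND-OFF.** Re-read in units of the
transferred-amplitude FLOOR (`0 < r ≤ 1 - e/K²⁰`), the hand-off maps the output cone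
`coneFrom c₀ (firedSet K e m)` INTO the input cone `coneFrom c₀ (closedBall delayInit ρ)` of the
SAME level `c₀ ≥ 0` (any `ρ ≥ 0`): a fired state `c • w`, `|w 4 - 1| ≤ e/K²⁰`, hands off
`(c · w 4 / r) • delayInit` with `c · w 4 / r ≥ c ≥ c₀`. So `taoReachCone` chains generation to
generation at the design level (zero junk) with no loss of level.
[cite: Tao2016AveragedNS, §6.1 (6.1), (6.4), Remark 6.1] -/
theorem handOff_image_coneFrom_firedSet_subset {K e m r c₀ ρ : ℝ} (hc₀ : 0 ≤ c₀) (hr : 0 < r)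
    (hre : r ≤ 1 - e / K ^ 20) (hρ : 0 ≤ ρ) :
    handOff r '' coneFrom c₀ (firedSet K e m) ⊆ coneFrom c₀ (closedBall delayInit ρ) := by
  rintro _ ⟨p, ⟨c, hc, w, hw, rfl⟩, rfl⟩
  have hw4 : 1 - e / K ^ 20 ≤ w 4 := by
    have := (abs_le.1 hw.1).1
    linarith
  have hwr : 1 ≤ w 4 / r := by
    rw [le_div_iff₀ hr]
    linarith
  refine ⟨c * (w 4 / r), ?_, delayInit, mem_closedBall_self hρ, ?_⟩
  · nlinarith
  · rw [handOff_smul, handOff, smul_smul]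

/-- **NO ISOTROPIC INPUT BALL RECEIVES THE HAND-OFF.** Whatever the unit `r`, the hand-off of the
fired set `firedSet K 6 4` is NOT contained in `closedBall delayInit ρ` once `ρ < 6/K²⁰` (`K ≥ 2`):
the two fired states `ã = 1 ± 6/K²⁰` hand off carriers `(1 ± 6/K²⁰)/r`, which cannot both be
`ρ`-close to `1`. Since the isotropic certificates exist only for `ρ < 1.2535·ε²e^{-M}/√M`
(`isEmpty_taoReach_of_ge`) `≪ 6/K²⁰`, they cannot be chained through the design hand-off under any
fixed renormalisation — the cone certificates (§5–§6) are the composable form.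
[cite: Tao2016AveragedNS, §5.5 Theorem 5.3, §6] -/
theorem not_handOff_image_firedSet_subset {K ρ : ℝ} (hK : 2 ≤ K) (hρ : ρ < 6 / K ^ 20) (r : ℝ) :
    ¬ (handOff r '' firedSet K 6 4 ⊆ closedBall delayInit ρ) := by
  intro hsub
  have hK0 : 0 < K := by linarith
  have hK20 : (2 : ℝ) ^ 20 ≤ K ^ 20 := pow_le_pow_left₀ (by norm_num) hK 20
  have ha : 0 < 6 / K ^ 20 := by positivity
  have ha1 : 6 / K ^ 20 < 1 := by
    rw [div_lt_one (by positivity)]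
    linarith [show (2 : ℝ) ^ 20 = 1048576 by norm_num]
  set a : ℝ := 6 / K ^ 20 with ha_def
  -- the two extreme fired states `ã = 1 ± a`, all other modes zero
  have hmem : ∀ s : ℝ, |s - 1| ≤ a → (Pi.single (4 : Fin 5) s : Fin 5 → ℝ) ∈ firedSet K 6 4 := by
    intro s hs
    refine ⟨by simpa using hs, fun i hi => ?_⟩
    rw [Pi.single_eq_of_ne hi, abs_zero]
    positivity
  have h4 : ∀ s : ℝ, (Pi.single (4 : Fin 5) s : Fin 5 → ℝ) 4 = s := fun s => by simp
  have hdist : ∀ s : ℝ, |s - 1| ≤ a → |s / r - 1| ≤ ρ := by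
    intro s hs
    have h := hsub ⟨_, hmem s hs, rfl⟩
    rwa [mem_closedBall, dist_eq_norm, norm_handOff_sub_delayInit, h4] at h
  have h1 := hdist (1 + a) (by rw [show (1 : ℝ) + a - 1 = a by ring, abs_of_pos ha])
  have h2 := hdist (1 - a) (by rw [show (1 : ℝ) - a - 1 = -a by ring, abs_neg, abs_of_pos ha])
  have hρ1 : ρ < 1 := hρ.trans ha1
  obtain ⟨h1l, h1u⟩ := abs_le.1 h1
  obtain ⟨h2l, h2u⟩ := abs_le.1 h2
  by_cases hr : 0 < r
  · have e1 : 1 + a ≤ (1 + ρ) * r := by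
      have := (div_le_iff₀ hr).1 (show (1 + a) / r ≤ 1 + ρ by linarith)
      linarith
    have e2 : (1 - ρ) * r ≤ 1 - a := by
      have := (le_div_iff₀ hr).1 (show 1 - ρ ≤ (1 - a) / r by linarith)
      linarith
    have e3 : (1 + a) * (1 - ρ) ≤ (1 + ρ) * (1 - a) :=
      calc (1 + a) * (1 - ρ) ≤ (1 + ρ) * r * (1 - ρ) :=
            mul_le_mul_of_nonneg_right e1 (by linarith)
        _ = (1 + ρ) * ((1 - ρ) * r) := by ring
        _ ≤ (1 + ρ) * (1 - a) := mul_le_mul_of_nonneg_left e2 (by linarith)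
    nlinarith [e3]
  · rw [not_lt] at hr
    have : (1 + a) / r ≤ 0 := div_nonpos_iff.2 (Or.inl ⟨by linarith, hr⟩)
    linarith

section StandingHandOff

variable {K M ε : ℝ} (hK : 2 * 20 ^ 42 * (Nat.factorial 42 : ℝ) + 16 ≤ K)
  (hML : 3000 * Real.log K ≤ M) (hMK : M ≤ K ^ 10) (hε : 0 < ε)
  (hεle : ε ≤ exp (-(10 * M)) / K ^ 100)
include hK hML hMK hε hεle

/-- The isotropic certified radii are far below the hand-off spread: `1.2535·ε²e^{-M}/√M < 6/K²⁰`
(indeed `ε² ≤ K⁻²⁰⁰`). [cite: Tao2016AveragedNS, §5.5 Theorem 5.3] -/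
theorem dudLevel_lt_handOff_spread :
    2507 / 2000 * (ε ^ 2 * exp (-M)) / Real.sqrt M < 6 / K ^ 20 := by
  obtain ⟨-, hε1, -, hexpM, -, -, -, hsq77, -⟩ := Ignition.ignition_params hK hML hMK hε hεle
  have hK1 : 1 ≤ K := by
    have : (0 : ℝ) ≤ 2 * 20 ^ 42 * (Nat.factorial 42 : ℝ) := by positivity
    linarith
  have hK0 : 0 < K := by linarith
  have hsq0 : 0 < Real.sqrt M := by linarith
  -- `ε ≤ 1/K¹⁰⁰ ≤ 1/K²⁰`
  have hε' : ε ≤ 1 / K ^ 20 := by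
    have h1 : exp (-(10 * M)) ≤ 1 := by
      rw [exp_le_one_iff]
      have : (0 : ℝ) ≤ M := by nlinarith [Real.sqrt_nonneg M, Real.sq_sqrt (show (0:ℝ) ≤ M by
        by_contra h; rw [not_le] at h; have := Real.sqrt_eq_zero'.2 h.le; linarith)]
      linarith
    have h2 : exp (-(10 * M)) / K ^ 100 ≤ 1 / K ^ 100 :=
      div_le_div_of_nonneg_right h1 (by positivity)
    have h3 : (1 : ℝ) / K ^ 100 ≤ 1 / K ^ 20 :=
      one_div_le_one_div_of_le (by positivity) (pow_le_pow_right₀ hK1 (by norm_num))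
    linarith
  -- `ε²e^{-M}/√M ≤ ε² ≤ ε/K²⁰`-type chain
  have hs : ε ^ 2 * exp (-M) / Real.sqrt M ≤ ε * (1 / K ^ 20) := by
    rw [div_le_iff₀ hsq0]
    have h1 : ε ^ 2 * exp (-M) ≤ ε ^ 2 * 1 := mul_le_mul_of_nonneg_left (by linarith) (sq_nonneg ε)
    have h2 : ε ^ 2 ≤ ε * (1 / K ^ 20) := by
      rw [pow_two]
      exact mul_le_mul_of_nonneg_left hε' hε.le
    have h3 : ε * (1 / K ^ 20) ≤ ε * (1 / K ^ 20) * Real.sqrt M := by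
      have : 0 ≤ ε * (1 / K ^ 20) := by positivity
      nlinarith
    linarith
  have hK20 : 0 < 1 / K ^ 20 := by positivity
  calc 2507 / 2000 * (ε ^ 2 * exp (-M)) / Real.sqrt M
      = 2507 / 2000 * (ε ^ 2 * exp (-M) / Real.sqrt M) := by ring
    _ ≤ 2507 / 2000 * (ε * (1 / K ^ 20)) := mul_le_mul_of_nonneg_left hs (by norm_num)
    _ ≤ 2507 / 2000 * (1 * (1 / K ^ 20)) := by gcongr
    _ < 6 / K ^ 20 := by rw [one_mul, div_eq_mul_one_div (6 : ℝ)]; nlinarith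

/-- **No isotropic certificate chains.** For every input radius `ρ < 1.2535·ε²e^{-M}/√M` — i.e.
for every `ρ` at which an isotropic reach certificate from `closedBall delayInit ρ` can exist at
all (`isEmpty_taoReach_of_ge`, ReachCertificateSharp.lean) — and every renormalisation unit `r`,
the design hand-off of the fired set misses the input ball: `handOff r '' firedSet K 6 4 ⊄
closedBall delayInit ρ`. The composable form is the cone certificate `taoReachCone`
(`handOff_image_coneFrom_firedSet_subset`). [cite: Tao2016AveragedNS, §5.5 Theorem 5.3, §6] -/
theorem not_handOff_of_lt_dudLevel {ρ : ℝ}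
    (hρ : ρ < 2507 / 2000 * (ε ^ 2 * exp (-M)) / Real.sqrt M) (r : ℝ) :
    ¬ (handOff r '' firedSet K 6 4 ⊆ closedBall delayInit ρ) := by
  have hK2 : 2 ≤ K := by
    have : (0 : ℝ) ≤ 2 * 20 ^ 42 * (Nat.factorial 42 : ℝ) := by positivity
    linarith
  exact not_handOff_image_firedSet_subset hK2
    (hρ.trans (dudLevel_lt_handOff_spread hK hML hMK hε hεle)) r

omit hML hMK hε hεle in
/-- **… while the cone certificate chains at the floor unit `r = 1 - 6/K²⁰`**: its output cone
hands off into its own input cone. [cite: Tao2016AveragedNS, §6.1 (6.1), (6.4), Remark 6.1] -/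
theorem handOff_taoReachCone_chains {c₀ ρ : ℝ} (hc₀ : 0 < c₀) (hρ : 0 ≤ ρ) :
    handOff (1 - 6 / K ^ 20) '' coneFrom c₀ (firedSet K 6 4) ⊆
      coneFrom c₀ (closedBall delayInit ρ) := by
  have hK2 : 2 ≤ K := by
    have : (0 : ℝ) ≤ 2 * 20 ^ 42 * (Nat.factorial 42 : ℝ) := by positivity
    linarith
  have hK20 : (2 : ℝ) ^ 20 ≤ K ^ 20 := pow_le_pow_left₀ (by norm_num) hK2 20
  have ha1 : 6 / K ^ 20 < 1 := by
    rw [div_lt_one (by positivity)]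
    linarith [show (2 : ℝ) ^ 20 = 1048576 by norm_num]
  exact handOff_image_coneFrom_firedSet_subset hc₀.le (by linarith) le_rfl hρ

end StandingHandOff

/-! ## §8. Bands: the gate preserves the level, the hand-off drifts it upward -/

/-- **The band over a set between levels `c₀ ≤ c ≤ c₁`**: all `c • q`, `q ∈ A`.
[cite: Tao2016AveragedNS, Remark 6.1] -/
def bandFrom (c₀ c₁ : ℝ) (A : Set (Fin 5 → ℝ)) : Set (Fin 5 → ℝ) :=
  {p | ∃ c : ℝ, c₀ ≤ c ∧ c ≤ c₁ ∧ ∃ q ∈ A, p = c • q}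

/-- Bands lie in cones. [folklore] -/
theorem bandFrom_subset_coneFrom (c₀ c₁ : ℝ) (A : Set (Fin 5 → ℝ)) :
    bandFrom c₀ c₁ A ⊆ coneFrom c₀ A := by
  rintro p ⟨c, hc, -, q, hq, rfl⟩
  exact ⟨c, hc, q, hq, rfl⟩

/-- Bands are monotone in the upper level. [folklore] -/
theorem bandFrom_mono_right {c₀ c₁ c₁' : ℝ} (h : c₁ ≤ c₁') (A : Set (Fin 5 → ℝ)) :
    bandFrom c₀ c₁ A ⊆ bandFrom c₀ c₁' A := by
  rintro p ⟨c, hc, hc1, q, hq, rfl⟩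
  exact ⟨c, hc, hc1.trans h, q, hq, rfl⟩

/-- Scaled members of `A` at a level in `[c₀, c₁]` lie in the band. [folklore] -/
theorem smul_mem_bandFrom {c₀ c₁ c : ℝ} {A : Set (Fin 5 → ℝ)} {q : Fin 5 → ℝ} (hc : c₀ ≤ c)
    (hc1 : c ≤ c₁) (hq : q ∈ A) : c • q ∈ bandFrom c₀ c₁ A :=
  ⟨c, hc, hc1, q, hq, rfl⟩

/-- **THE GATE PRESERVES THE LEVEL: the banded certificate.** Under the hypotheses of
`reachCertificateCone` and for every upper level `c₁`, the reach interface is inhabited from the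
INPUT BAND `bandFrom c₀ c₁ (closedBall delayInit ρ)` into the OUTPUT BAND `bandFrom c₀ c₁ A` with
the SAME levels (working region `univ`, defect `εd`, cycle time `2/c₀`): an input at level `c` is
delivered at level exactly `c` (`coneCertificate_core`). [cite: Tao2016AveragedNS, §5.5 Theorem 5.3, Remark 6.1] -/
def reachCertificateBand {K M ε c₀ ρ εd : ℝ} {A : Set (Fin 5 → ℝ)}
    (hF : ∀ x : ℝ → Fin 5 → ℝ, IsPseudoOrbit (delayCircuitWith K M ε) (εd / c₀ ^ 2) 2 2 x →
      ‖x 0 - delayInit‖ ≤ ρ → x 2 ∈ A)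
    (hc₀ : 0 < c₀) (hρ : 0 ≤ ρ) (hεd : 0 ≤ εd)
    (hsm : 7 * ρ + 40 * (εd / c₀ ^ 2) ≤ 5 / 4) (c₁ : ℝ) :
    ReachCertificate (delayCircuitWith K M ε) (univ : Set (Fin 5 → ℝ)) εd (2 / c₀)
      (bandFrom c₀ c₁ (closedBall delayInit ρ)) (bandFrom c₀ c₁ A) where
  Tube p σ := (reachCertificateCone hF hc₀ hρ hεd hsm).Tube p σ
  Tube_closed p hp :=
    (reachCertificateCone hF hc₀ hρ hεd hsm).Tube_closed p (bandFrom_subset_coneFrom _ _ _ hp)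
  Tube_zero p hp :=
    (reachCertificateCone hF hc₀ hρ hεd hsm).Tube_zero p (bandFrom_subset_coneFrom _ _ _ hp)
  Tube_sub _ _ _ _ := subset_univ _
  cert p hp σT y h0 hσT hy0 hcont _ hW := by
    obtain ⟨c, hc, hc1, q, hq, rfl⟩ := hp
    obtain ⟨h1, h2⟩ := coneCertificate_core hF hc₀ hεd hsm hc hq h0 hσT hy0 hcont hW
    refine ⟨h1, fun hτ => ?_⟩
    obtain ⟨hI, w, hw, hyw⟩ := h2 hτ
    exact ⟨2 / c, hI, by rw [hyw]; exact ⟨c, hc, hc1, w, hw, rfl⟩⟩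

section StandingBand

variable {K M ε : ℝ} (hK : 2 * 20 ^ 42 * (Nat.factorial 42 : ℝ) + 16 ≤ K)
  (hML : 3000 * Real.log K ≤ M) (hMK : M ≤ K ^ 10) (hε : 0 < ε)
  (hεle : ε ≤ exp (-(10 * M)) / K ^ 100)
include hK hML hMK hε hεle

/-- **Tao's gate on BANDS**: under the standing hypotheses, for every `0 < c₀`, every `c₁` and
`ρ, εd ≥ 0` with `ρ + 2εd/c₀² < 1.2532·ε²e^{-M}/√M`, a reach certificate from
`bandFrom c₀ c₁ (closedBall delayInit ρ)` into `bandFrom c₀ c₁ (firedSet K 6 4)` — levels preserved.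
[cite: Tao2016AveragedNS, §5.5 Theorem 5.3, Remark 6.1] -/
def taoReachBand {c₀ ρ εd : ℝ} (hc₀ : 0 < c₀) (hρ : 0 ≤ ρ) (hεd : 0 ≤ εd)
    (hB : ρ + εd / c₀ ^ 2 * 2 < 3133 / 2500 * (ε ^ 2 * exp (-M)) / Real.sqrt M) (c₁ : ℝ) :
    ReachCertificate (delayCircuitWith K M ε) (univ : Set (Fin 5 → ℝ)) εd (2 / c₀)
      (bandFrom c₀ c₁ (closedBall delayInit ρ)) (bandFrom c₀ c₁ (firedSet K 6 4)) :=
  reachCertificateBand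
    (fun x hx h0 =>
      (firesUnderBudget_of_lt hK hML hMK hε hεle hB (by norm_num) (by norm_num)) _ _ 2 x le_rfl hx
        h0 le_rfl 2 ⟨le_rfl, le_rfl⟩)
    hc₀ hρ hεd
    (by
      obtain ⟨h1, h2⟩ := dud_level_le hK hML hMK hε hεle
      have : 0 ≤ εd / c₀ ^ 2 := by positivity
      linarith)
    c₁

end StandingBand

/-- **THE HAND-OFF DRIFTS THE LEVEL UPWARD BY AT MOST `(1 + e/K²⁰)/r` PER GENERATION.** Re-read in
a unit `0 < r ≤ 1 - e/K²⁰`, the design hand-off maps the output band `bandFrom c₀ c₁ (firedSet K e m)`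
(`c₀ ≥ 0`) into the input band `bandFrom c₀ (c₁ · (1 + e/K²⁰)/r) (closedBall delayInit ρ)`: the
lower level is kept, the upper level grows by the factor `(1 + e/K²⁰)/r` (`= (1 + a)/(1 - a)`,
`a = e/K²⁰`, at the floor unit). Iterating: after `n` generations of `taoReachBand` + hand-off the
levels lie in `[c₀, c₁ ((1 + a)/(1 - a))ⁿ]` — bounded by `c₁ e^{3an}` for `a ≤ 1/2`, NOT bounded
uniformly in `n`: the per-generation energies of a cascade spec can only be FLOORS
(DIVERGENCE D37 (d)). [cite: Tao2016AveragedNS, §6.1 (6.1), (6.4), Remark 6.1] -/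
theorem handOff_image_bandFrom_firedSet_subset {K e m r c₀ c₁ ρ : ℝ} (hc₀ : 0 ≤ c₀) (hr : 0 < r)
    (hre : r ≤ 1 - e / K ^ 20) (hρ : 0 ≤ ρ) :
    handOff r '' bandFrom c₀ c₁ (firedSet K e m) ⊆
      bandFrom c₀ (c₁ * ((1 + e / K ^ 20) / r)) (closedBall delayInit ρ) := by
  rintro _ ⟨p, ⟨c, hc, hc1, w, hw, rfl⟩, rfl⟩
  obtain ⟨hw4l, hw4u⟩ := abs_le.1 hw.1
  have ha : 0 ≤ e / K ^ 20 := (abs_nonneg _).trans hw.1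
  have hw4 : 1 - e / K ^ 20 ≤ w 4 := by linarith
  have hwr : 1 ≤ w 4 / r := by
    rw [le_div_iff₀ hr]
    linarith
  have hwr' : w 4 / r ≤ (1 + e / K ^ 20) / r :=
    div_le_div_of_nonneg_right (by linarith) hr.le
  have hc0 : 0 ≤ c := hc₀.trans hc
  refine ⟨c * (w 4 / r), ?_, ?_, delayInit, mem_closedBall_self hρ, ?_⟩
  · nlinarith
  · exact mul_le_mul hc1 hwr' (by positivity) (hc0.trans hc1)
  · rw [handOff_smul, handOff, smul_smul]

end Literature.Analysis.FluidPDE.Tao2016AveragedNS
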